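import Summits.FinalStateConjecture.FinalStateConjecture.Theorems.EIHFluxBalanceInertialRecessionStubQuasiStationarityReduction
import Summits.FinalStateConjecture.FinalStateConjecture.Theorems.EIHFluxBalanceInertialRecessionStubWeightedRatesAxisChannel

/-!
# Route EIHFluxBalance — `InertialRecession`, line `sublinear-is-free-clean-window-charges`,
# stub `stub_weightedRates`: quasi-stationarity from the weighted 4-VELOCITY rates alone

Final file of the worker on `stub_weightedRates` (crux `stmt-FinalStateConjecture-10166`). The
landed reduction `…StubQuasiStationarityReduction.stub_quasiStationarity_of_weightedRates` derives
the quasi-stationarity clause QS of the line from the antecedent, third-order slaving and the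
WEIGHTED RATES `t^{3/4}‖(Λᵢe₀)˙‖ → 0` AND, for spinning holes, `t^{3/4}‖(Λᵢe₃)˙‖ → 0`. With the
refined structural estimate `…StubWeightedRatesAxisChannel.norm_fderiv_summand_basisVector_zero_le_columns`
(the spin-axis rate has kernel `M|a|/d²`, not `M/d`) the second clause is not needed: against the
weight `1 + d^{7/4}` the axis channel leaves `M|a|‖(Λe₃)˙‖(d^{-1/4} + d^{-2})`, and third-order
slaving makes `‖(Λᵢe₃)˙‖` eventually bounded (it tends to `0`).

* `eventually_weighted_fderiv_summand_le_e0` — per-hole eventual weighted estimate from the weighted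
  4-velocity rate, a bound of the drift and (if `a ≠ 0`) a bound of the axis rate;
* `weighted_fderiv_background_tendsto_zero_e0` — the kinematic core for `N` holes;
* `stub_quasiStationarity_of_weightedRates_e0` — the registered QS signature VERBATIM with the single
  extra hypothesis RATES_e0 `∀ i, t^{3/4}‖(Λᵢe₀)˙‖ → 0` inserted after the slaving block.

So the dynamical input of quasi-stationarity is the weighted rate of the painted 4-VELOCITIES only.
-/

set_option linter.dupNamespace false

noncomputable section

namespace Summit.FinalStateConjecture.FinalStateConjecture.Theorems.SublinearIsFree.WeightedRates

open scoped BigOperators Topology ContDiff ENNReal Manifold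
open Filter Set Function TopologicalSpace Literature.Geometry.Lorentzian
open Summit.FinalStateConjecture.FinalStateConjecture.Theorems
open Summit.FinalStateConjecture.FinalStateConjecture.Theorems.InertialRecession.Negative
open Summit.FinalStateConjecture.FinalStateConjecture.Theorems.SublinearIsFree.QuasiStationarity

/-! ### The per-hole eventual estimate from the 4-velocity rate -/

-- operator-norm instance paths on form-valued maps are slow to unify
set_option synthInstance.maxHeartbeats 200000 in
set_option maxHeartbeats 800000 in
/-- **Per-hole eventual weighted estimate from the weighted 4-velocity rate.** For one summand `Sᵢ`
of the background field with `C¹` motion of Lorentz factor `≤ γ`, centre eventually inside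
`‖ξ(t)‖ ≤ κ²t` (`0 ≤ κ ≤ 1`), eventually bounded drift `‖ξ̇(t)‖ ≤ V`, eventually bounded spin-axis
rate `‖(Λe₃)˙(t)‖ ≤ V₃` when `a ≠ 0`, and the WEIGHTED 4-VELOCITY RATE `t^{3/4}‖(Λe₀)˙(t)‖ → 0`: for
every exclusion radius `ρ(t) → ∞` and every `δ > 0`, eventually in `t`,
`(1 + √(√(dᵢ⁷))) ‖D Sᵢ(x)[e₀]‖ ≤ δ` for all slab points `x` (`x⁰ = t`) in the cone `|x̲| ≤ κt` with
`dᵢ = ‖x̲ − ξ(t)‖ ≥ ρ(t)` (the axis and drift channels share the kernel `1/d²`, on which the weight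
leaves `d^{-1/4} ≤ ρ(t)^{-1/4}`). [folklore] -/
theorem eventually_weighted_fderiv_summand_le_e0 {M a γ κ V V₃ : ℝ} {Λ : ℝ → lorentzGroup}
    {ξ : ℝ → E3}
    (hΛ : ContDiff ℝ 1 (fun s ↦ ((Λ s : E4 ≃L[ℝ] E4) : E4 →L[ℝ] E4))) (hξ : ContDiff ℝ 1 ξ)
    (hγ : ∀ t, |((Λ t : E4 ≃L[ℝ] E4) (E4.basisVector 0)) 0| ≤ γ) (hκ0 : 0 ≤ κ) (hκ1 : κ ≤ 1)
    (hξκ : ∀ᶠ t in atTop, ‖ξ t‖ ≤ κ ^ 2 * t) (hV : ∀ᶠ t in atTop, ‖deriv ξ t‖ ≤ V)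
    (hV₃ : a ≠ 0 → ∀ᶠ t in atTop,
      ‖deriv (fun s ↦ (Λ s : E4 ≃L[ℝ] E4) (E4.basisVector 3)) t‖ ≤ V₃)
    (hrate : Tendsto (fun t ↦ t ^ (3 / 4 : ℝ) *
      ‖deriv (fun s ↦ (Λ s : E4 ≃L[ℝ] E4) (E4.basisVector 0)) t‖) atTop (𝓝 0))
    {ρ : ℝ → ℝ} (hρ : Tendsto ρ atTop atTop) {δ : ℝ} (hδ : 0 < δ) :
    ∀ᶠ t in atTop, ∀ x : E4, x 0 = t → E4.spatialNorm x ≤ κ * t → ρ t ≤ ‖E4.spatial x - ξ t‖ →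
      (1 + √(√(‖E4.spatial x - ξ t‖ ^ 7))) *
        ‖fderiv ℝ (fun y : E4 ↦ boostedKerrBilin (Λ (y 0)) (E4.ofTimeSpace (y 0) (ξ (y 0))) M a y -
          Minkowski.bilin) x (E4.basisVector 0)‖ ≤ δ := by
  obtain ⟨B₀, B₁, Bₐ, hB₀, hB₁, hBₐ, hmain⟩ := norm_fderiv_summand_basisVector_zero_le_columns
  -- constants of the hole (no `set`: the context will be large)
  have hγ1 : 1 ≤ γ := (one_le_abs_lorentz_apply_zero (Λ 0)).trans (hγ 0)
  have hG0 : 0 ≤ 1 + 3 * γ := by linarith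
  obtain ⟨C₁, hC₁⟩ : ∃ C₁ : ℝ,
      C₁ = |M| * (1 + 3 * γ) ^ 2 * (B₁ * (1 + 3 * γ) + 2 * B₀) * (4 * (1 + 3 * γ)) := ⟨_, rfl⟩
  obtain ⟨C₂, hC₂⟩ : ∃ C₂ : ℝ, C₂ = |M| * (1 + 3 * γ) ^ 2 * (B₁ * (1 + 3 * γ)) * max V 0 +
      |M| * Bₐ * (1 + 3 * γ) ^ 3 * (8 * (1 + 3 * γ) + 16) * (|a| * max V₃ 0) := ⟨_, rfl⟩
  have hC₁0 : 0 ≤ C₁ := by rw [hC₁]; positivity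
  have hC₂0 : 0 ≤ C₂ := by rw [hC₂]; positivity
  obtain ⟨η, hη⟩ : ∃ η : ℝ, η = δ / (16 * C₁ + 2 * C₂ * 1 + 1) := ⟨_, rfl⟩
  have hden : 0 < 16 * C₁ + 2 * C₂ * 1 + 1 := by positivity
  have hη0 : 0 < η := by rw [hη]; exact div_pos hδ hden
  have hηδ : (16 * C₁ + 2 * C₂ * 1) * η ≤ δ := by
    rw [hη, mul_div_assoc', div_le_iff₀ hden]
    nlinarith
  -- eventual conditions
  have h4 : ∀ᶠ t in atTop, t ^ (3 / 4 : ℝ) *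
      ‖deriv (fun s ↦ (Λ s : E4 ≃L[ℝ] E4) (E4.basisVector 0)) t‖ < η :=
    hrate.eventually (gt_mem_nhds hη0)
  have h3 : ∀ᶠ t in atTop, |a| * ‖deriv (fun s ↦ (Λ s : E4 ≃L[ℝ] E4) (E4.basisVector 3)) t‖ ≤
      |a| * max V₃ 0 := by
    by_cases ha : a = 0
    · exact Eventually.of_forall fun t ↦ by simp [ha]
    · filter_upwards [hV₃ ha] with t ht
      exact mul_le_mul_of_nonneg_left (ht.trans (le_max_left _ _)) (abs_nonneg a)
  filter_upwards [eventually_ge_atTop (1 : ℝ), hξκ, hV, h4, h3,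
    hρ.eventually_ge_atTop (max 1 (2 * |a|)), hρ.eventually_ge_atTop (η⁻¹ ^ 4)]
    with t ht1 ht2 ht3 ht4 ht5 ht6 ht7
  intro x hx hcone hρx
  have hd : max 1 (2 * |a|) ≤ ‖E4.spatial x - ξ t‖ := ht6.trans hρx
  have hd1 : 1 ≤ ‖E4.spatial x - ξ t‖ := (le_max_left _ _).trans hd
  have hd0 : 0 < ‖E4.spatial x - ξ t‖ := one_pos.trans_le hd1
  have ht0 : 0 ≤ t := zero_le_one.trans ht1
  -- the structural estimate at `x`
  have hΛ' : HasDerivAt (fun s ↦ ((Λ s : E4 ≃L[ℝ] E4) : E4 →L[ℝ] E4))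
      (deriv (fun s ↦ ((Λ s : E4 ≃L[ℝ] E4) : E4 →L[ℝ] E4)) t) t :=
    (hΛ.differentiable one_ne_zero t).hasDerivAt
  have hbound := hmain M a γ Λ ξ t x hΛ hξ (hγ t) hx hd
  rw [← deriv_lorentz_apply_basisVector hΛ' 0, ← deriv_lorentz_apply_basisVector hΛ' 3] at hbound
  clear hmain
  obtain ⟨r, hr⟩ : ∃ r : ℝ, r = ‖deriv (fun s ↦ (Λ s : E4 ≃L[ℝ] E4) (E4.basisVector 0)) t‖ :=
    ⟨_, rfl⟩
  obtain ⟨r₃, hr₃⟩ : ∃ r₃ : ℝ, r₃ = ‖deriv (fun s ↦ (Λ s : E4 ≃L[ℝ] E4) (E4.basisVector 3)) t‖ :=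
    ⟨_, rfl⟩
  rw [← hr, ← hr₃] at hbound
  rw [← hr] at ht4
  rw [← hr₃] at ht5
  have hr0 : 0 ≤ r := by rw [hr]; positivity
  have hr₃0 : 0 ≤ r₃ := by rw [hr₃]; positivity
  have hrate_t : t ^ (3 / 4 : ℝ) * r ≤ η := ht4.le
  -- fourth roots
  obtain ⟨hs0, hs4, hs7⟩ := fourthRoot_props (zero_le_one.trans hd1)
  obtain ⟨hτ0, hτ4, -⟩ := fourthRoot_props ht0
  obtain ⟨s, hs⟩ : ∃ s : ℝ, s = √(√‖E4.spatial x - ξ t‖) := ⟨_, rfl⟩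
  obtain ⟨τ, hτ⟩ : ∃ τ : ℝ, τ = √(√t) := ⟨_, rfl⟩
  rw [← hs] at hs0 hs4 hs7
  rw [← hτ] at hτ0 hτ4
  have hs1 : 1 ≤ s := by
    by_contra h
    have h' : s < 1 := lt_of_not_ge h
    have : s ^ 4 < 1 := pow_lt_one₀ hs0 h' (by norm_num)
    linarith
  have hd2t : ‖E4.spatial x - ξ t‖ ≤ 2 * t := by
    have h1 : ‖E4.spatial x - ξ t‖ ≤ ‖E4.spatial x‖ + ‖ξ t‖ := norm_sub_le _ _
    have h2 : ‖E4.spatial x‖ ≤ κ * t := hcone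
    have h3 : κ * t ≤ 1 * t := mul_le_mul_of_nonneg_right hκ1 ht0
    have hκ2 : κ ^ 2 ≤ 1 := pow_le_one₀ hκ0 hκ1
    have h4 : κ ^ 2 * t ≤ 1 * t := mul_le_mul_of_nonneg_right hκ2 ht0
    linarith
  have hsτ : s ≤ 2 * τ := by
    have h : s ^ 4 ≤ (2 * τ) ^ 4 := by
      rw [hs4, mul_pow, hτ4]
      linarith
    exact (pow_le_pow_iff_left₀ hs0 (by positivity) (by norm_num)).mp h
  have hsη : η⁻¹ ≤ s := by
    have h : (η⁻¹) ^ 4 ≤ s ^ 4 := by rw [hs4]; exact ht7.trans hρx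
    exact (pow_le_pow_iff_left₀ (by positivity) hs0 (by norm_num)).mp h
  have hrτ : τ ^ 3 * r ≤ η := by rwa [rpow_three_quarters_eq ht0, ← hτ] at hrate_t
  have hVt : ‖deriv ξ t‖ ≤ max V 0 := ht3.trans (le_max_left _ _)
  -- assemble: the structural estimate is `≤ C₁ r / d + C₂ / d²`
  have hstep : |M| * (1 + 3 * γ) ^ 2 * ((B₁ * (1 + 3 * γ) + 2 * B₀) * (4 * (1 + 3 * γ) * r) /
        ‖E4.spatial x - ξ t‖ + B₁ * (1 + 3 * γ) * ‖deriv ξ t‖ / ‖E4.spatial x - ξ t‖ ^ 2) +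
      |M| * Bₐ * |a| * (1 + 3 * γ) ^ 3 * (8 * (1 + 3 * γ) + 16) * r₃ / ‖E4.spatial x - ξ t‖ ^ 2 ≤
      C₁ * r / s ^ 4 + C₂ * 1 / (s ^ 4) ^ 2 := by
    rw [hs4]
    have h1 : |M| * (1 + 3 * γ) ^ 2 * ((B₁ * (1 + 3 * γ) + 2 * B₀) * (4 * (1 + 3 * γ) * r) /
        ‖E4.spatial x - ξ t‖ + B₁ * (1 + 3 * γ) * ‖deriv ξ t‖ / ‖E4.spatial x - ξ t‖ ^ 2) +
        |M| * Bₐ * |a| * (1 + 3 * γ) ^ 3 * (8 * (1 + 3 * γ) + 16) * r₃ / ‖E4.spatial x - ξ t‖ ^ 2 =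
        C₁ * r / ‖E4.spatial x - ξ t‖ +
          (|M| * (1 + 3 * γ) ^ 2 * (B₁ * (1 + 3 * γ)) * ‖deriv ξ t‖ +
            |M| * Bₐ * (1 + 3 * γ) ^ 3 * (8 * (1 + 3 * γ) + 16) * (|a| * r₃)) /
            ‖E4.spatial x - ξ t‖ ^ 2 := by
      rw [hC₁]; ring
    rw [h1]
    have h2 : |M| * (1 + 3 * γ) ^ 2 * (B₁ * (1 + 3 * γ)) * ‖deriv ξ t‖ +
        |M| * Bₐ * (1 + 3 * γ) ^ 3 * (8 * (1 + 3 * γ) + 16) * (|a| * r₃) ≤ C₂ * 1 := by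
      rw [hC₂, mul_one]
      gcongr
    have h3 : (|M| * (1 + 3 * γ) ^ 2 * (B₁ * (1 + 3 * γ)) * ‖deriv ξ t‖ +
        |M| * Bₐ * (1 + 3 * γ) ^ 3 * (8 * (1 + 3 * γ) + 16) * (|a| * r₃)) /
        ‖E4.spatial x - ξ t‖ ^ 2 ≤ C₂ * 1 / ‖E4.spatial x - ξ t‖ ^ 2 :=
      div_le_div_of_nonneg_right h2 (by positivity)
    linarith
  have hw := weight_arith hs1 hsτ hη0 hsη hr0 hrτ zero_le_one hC₁0 hC₂0
  rw [hs7]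
  calc (1 + s ^ 7) * ‖fderiv ℝ (fun y : E4 ↦ boostedKerrBilin (Λ (y 0))
        (E4.ofTimeSpace (y 0) (ξ (y 0))) M a y - Minkowski.bilin) x (E4.basisVector 0)‖
      ≤ (1 + s ^ 7) * (C₁ * r / s ^ 4 + C₂ * 1 / (s ^ 4) ^ 2) :=
        mul_le_mul_of_nonneg_left (hbound.trans hstep) (by positivity)
    _ ≤ (16 * C₁ + 2 * C₂ * 1) * η := hw
    _ ≤ δ := hηδ

/-! ### The kinematic core for `N` holes -/

-- operator-norm instance paths on form-valued maps are slow to unify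
set_option synthInstance.maxHeartbeats 200000 in
/-- **Eventual weighted estimate for the whole background field from the weighted 4-velocity
rates** (the `e₀`-only form of `eventually_weighted_fderiv_background_le`): for `C¹` motions of
Lorentz factor `≤ γ`, centres eventually in `‖ξᵢ(t)‖ ≤ κ²t`, eventually bounded drifts, eventually
bounded spin-axis rates of the spinning holes, and `t^{3/4}‖(Λᵢe₀)˙‖ → 0`: for every `ε > 0`,
eventually in `t`, `(1 + √(√(d⁷))) ‖D G(x)[e₀]‖ ≤ ε` for all slab points `x` in the cone with
`d = minᵢ ‖x̲ − ξᵢ(t)‖ ≥ ρ(t)`. [folklore] -/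
theorem eventually_weighted_fderiv_background_le_e0 (N : ℕ) (M a : Fin N → ℝ)
    (Λ : Fin N → ℝ → lorentzGroup) (ξ : Fin N → ℝ → E3) (γ κ : ℝ)
    (hγ : ∀ i t, |((Λ i t : E4 ≃L[ℝ] E4) (E4.basisVector 0)) 0| ≤ γ)
    (hsmooth : ∀ i, ContDiff ℝ 1 (ξ i) ∧
      ContDiff ℝ 1 (fun t ↦ ((Λ i t : E4 ≃L[ℝ] E4) : E4 →L[ℝ] E4)))
    (hκ : 0 ≤ κ ∧ κ ≤ 1 ∧ ∀ i, ∀ᶠ t in atTop, ‖ξ i t‖ ≤ κ ^ 2 * t)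
    (hV : ∀ i, ∃ V : ℝ, ∀ᶠ t in atTop, ‖deriv (ξ i) t‖ ≤ V)
    (hV₃ : ∀ i, ∃ V₃ : ℝ, a i ≠ 0 → ∀ᶠ t in atTop,
      ‖deriv (fun s ↦ (((Λ i s : lorentzGroup) : E4 ≃L[ℝ] E4) (E4.basisVector 3))) t‖ ≤ V₃)
    (hrate : ∀ i : Fin N, Tendsto (fun t : ℝ ↦ t ^ (3 / 4 : ℝ) *
        ‖deriv (fun s ↦ (((Λ i s : lorentzGroup) : E4 ≃L[ℝ] E4) (E4.basisVector 0))) t‖)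
        atTop (𝓝 0))
    {ρ : ℝ → ℝ} (hρ : Tendsto ρ atTop atTop) {ε : ℝ} (hε : 0 < ε) :
    ∀ᶠ t in atTop, ∀ x : E4, x 0 = t → E4.spatialNorm x ≤ κ * t →
      ρ t ≤ (⨅ i, ‖E4.spatial x - ξ i t‖) →
      (1 + √(√((⨅ i, ‖E4.spatial x - ξ i t‖) ^ 7))) *
        ‖fderiv ℝ (fun y : E4 ↦ Minkowski.bilin + ∑ i, (boostedKerrBilin (Λ i (y 0))
          (E4.ofTimeSpace (y 0) (ξ i (y 0))) (M i) (a i) y - Minkowski.bilin)) x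
          (E4.basisVector 0)‖ ≤ ε := by
  -- per-hole budget
  have hδ : 0 < ε / (N + 1) := div_pos hε (by positivity)
  have hev : ∀ i, ∀ᶠ t in atTop, ∀ x : E4, x 0 = t → E4.spatialNorm x ≤ κ * t →
      ρ t ≤ ‖E4.spatial x - ξ i t‖ →
      (1 + √(√(‖E4.spatial x - ξ i t‖ ^ 7))) *
        ‖fderiv ℝ (fun y : E4 ↦ boostedKerrBilin (Λ i (y 0)) (E4.ofTimeSpace (y 0) (ξ i (y 0)))
          (M i) (a i) y - Minkowski.bilin) x (E4.basisVector 0)‖ ≤ ε / (N + 1) := by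
    intro i
    obtain ⟨V, hVi⟩ := hV i
    obtain ⟨V₃, hV₃i⟩ := hV₃ i
    exact eventually_weighted_fderiv_summand_le_e0 (hsmooth i).2 (hsmooth i).1 (hγ i) hκ.1 hκ.2.1
      (hκ.2.2 i) hVi hV₃i (hrate i) hρ hδ
  have hfar : ∀ i, ∀ᶠ t in atTop, max 1 (2 * |a i|) ≤ ρ t := fun i ↦ hρ.eventually_ge_atTop _
  filter_upwards [eventually_all.2 hev, eventually_all.2 hfar] with t ht htfar
  intro x hx0 hcone hρx
  -- every hole is far
  have hinf_le : ∀ i, (⨅ j, ‖E4.spatial x - ξ j t‖) ≤ ‖E4.spatial x - ξ i t‖ := fun i ↦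
    ciInf_le ⟨0, by rintro _ ⟨j, rfl⟩; exact norm_nonneg _⟩ i
  have hinf0 : 0 ≤ ⨅ j, ‖E4.spatial x - ξ j t‖ := Real.iInf_nonneg fun _ ↦ norm_nonneg _
  have hdi : ∀ i, max 1 (2 * |a i|) ≤ ‖E4.spatial x - ξ i t‖ := fun i ↦
    (htfar i).trans (hρx.trans (hinf_le i))
  have hdiff := fun i ↦ (contDiffAt_summand (M := M i) (a := a i) (hsmooth i).2 (hsmooth i).1
    hx0 (hdi i)).differentiableAt one_ne_zero
  have hW0 : 0 ≤ 1 + √(√((⨅ i, ‖E4.spatial x - ξ i t‖) ^ 7)) := by positivity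
  refine (mul_le_mul_of_nonneg_left (norm_fderiv_background_basisVector_zero_le hdiff) hW0).trans
    ?_
  rw [Finset.mul_sum]
  have hterm : ∀ i, (1 + √(√((⨅ i, ‖E4.spatial x - ξ i t‖) ^ 7))) *
      ‖fderiv ℝ (fun y : E4 ↦ boostedKerrBilin (Λ i (y 0))
          (E4.ofTimeSpace (y 0) (ξ i (y 0))) (M i) (a i) y - Minkowski.bilin) x (E4.basisVector 0)‖ ≤
      ε / (N + 1) := fun i ↦ by
    have hWi : 1 + √(√((⨅ i, ‖E4.spatial x - ξ i t‖) ^ 7)) ≤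
        1 + √(√(‖E4.spatial x - ξ i t‖ ^ 7)) :=
      add_le_add le_rfl (weight_mono hinf0 (hinf_le i))
    exact (mul_le_mul_of_nonneg_right hWi (norm_nonneg (fderiv ℝ (fun y : E4 ↦
      boostedKerrBilin (Λ i (y 0)) (E4.ofTimeSpace (y 0) (ξ i (y 0))) (M i) (a i) y -
        Minkowski.bilin) x (E4.basisVector 0)))).trans
      (ht i x hx0 hcone (hρx.trans (hinf_le i)))
  refine (Finset.sum_le_sum fun i _ ↦ hterm i).trans ?_
  rw [Finset.sum_const, Finset.card_univ, Fintype.card_fin, nsmul_eq_mul, mul_div_assoc',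
    div_le_iff₀ (by positivity)]
  nlinarith

/-- **Quasi-stationarity of the modulated background at the weighted rate, from the weighted
4-velocity rates of the moduli** (`e₀`-only form of `weighted_fderiv_background_tendsto_zero`).
[folklore] -/
theorem weighted_fderiv_background_tendsto_zero_e0 (N : ℕ) (M a : Fin N → ℝ)
    (Λ : Fin N → ℝ → lorentzGroup) (ξ : Fin N → ℝ → E3) (γ κ : ℝ)
    (hγ : ∀ i t, |((Λ i t : E4 ≃L[ℝ] E4) (E4.basisVector 0)) 0| ≤ γ)
    (hsmooth : ∀ i, ContDiff ℝ 1 (ξ i) ∧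
      ContDiff ℝ 1 (fun t ↦ ((Λ i t : E4 ≃L[ℝ] E4) : E4 →L[ℝ] E4)))
    (hκ : 0 ≤ κ ∧ κ ≤ 1 ∧ ∀ i, ∀ᶠ t in atTop, ‖ξ i t‖ ≤ κ ^ 2 * t)
    (hV : ∀ i, ∃ V : ℝ, ∀ᶠ t in atTop, ‖deriv (ξ i) t‖ ≤ V)
    (hV₃ : ∀ i, ∃ V₃ : ℝ, a i ≠ 0 → ∀ᶠ t in atTop,
      ‖deriv (fun s ↦ (((Λ i s : lorentzGroup) : E4 ≃L[ℝ] E4) (E4.basisVector 3))) t‖ ≤ V₃)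
    (hrate : ∀ i : Fin N, Tendsto (fun t : ℝ ↦ t ^ (3 / 4 : ℝ) *
        ‖deriv (fun s ↦ (((Λ i s : lorentzGroup) : E4 ≃L[ℝ] E4) (E4.basisVector 0))) t‖)
        atTop (𝓝 0))
    (ρ : ℝ → ℝ) (hρ : Tendsto ρ atTop atTop) :
    Tendsto (fun t : ℝ ↦ ⨆ x ∈ {x : E4 | x 0 = t ∧ E4.spatialNorm x ≤ κ * t ∧
        ρ t ≤ ⨅ i, ‖E4.spatial x - ξ i t‖},
      ENNReal.ofReal (1 + √(√((⨅ i, ‖E4.spatial x - ξ i t‖) ^ 7))) *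
        ‖fderiv ℝ (fun y : E4 ↦ Minkowski.bilin + ∑ i, (boostedKerrBilin (Λ i (y 0))
          (E4.ofTimeSpace (y 0) (ξ i (y 0))) (M i) (a i) y - Minkowski.bilin)) x
          (E4.basisVector 0)‖ₑ) atTop (𝓝 0) := by
  refine tendsto_biSup_zero_of_eventually fun ε hε ↦ ?_
  filter_upwards [eventually_weighted_fderiv_background_le_e0 N M a Λ ξ γ κ hγ hsmooth hκ hV hV₃
    hrate hρ hε] with t ht
  rintro x ⟨hx0, hcone, hρx⟩
  rw [ofReal_mul_enorm (by positivity)]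
  exact ENNReal.ofReal_le_ofReal (ht x hx0 hcone hρx)

/-! ### The registered QS stub with the weighted 4-velocity rates as the only extra hypothesis -/

-- operator-norm instance paths on form-valued maps are slow to unify
set_option synthInstance.maxHeartbeats 200000 in
/-- **Stub `stub_quasiStationarity` of the line `sublinear-is-free-clean-window-charges`, REDUCED
TO THE WEIGHTED 4-VELOCITY RATES** (worker carrier `stub_quasiStationarity_of_weightedRates_e0`).
The registered QS signature verbatim (antecedent of the crux `InertialRecession`, then the third-order
slaving block), with ONE extra hypothesis inserted before the conclusion: for every hole,
`t^{3/4}‖(Λᵢe₀)˙(t)‖ → 0` — and NOTHING about the spin axes (cf. the landed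
`stub_quasiStationarity_of_weightedRates`, which also assumed `t^{3/4}‖(Λᵢe₃)˙‖ → 0` for `aᵢ ≠ 0`).
Conclusion: for every `ρ(t) → ∞`, quasi-stationarity of the modulated background at the weighted rate
`1 + d^{7/4}` on the lab slabs inside the cone `|x̲| ≤ κt` at distance `≥ ρ(t)` from all painted
centres. Used from the antecedent: Lorentz-factor, smoothness and cone clauses; from slaving: the
order-`0` translational clause (bounded drift) and, for spinning holes, the order-`1` axis clause
(bounded axis rate). [folklore] -/
theorem stub_quasiStationarity_of_weightedRates_e0 : ∀ (X : Type) [TopologicalSpace X] [ChartedSpace E3 X] [IsManifold (𝓡 3) ((⊤ : ℕ∞) : WithTop ℕ∞) X] [T2Space X] [SecondCountableTopology X] [ConnectedSpace X], ∀ D ∈ admissibleVacuumData X, ∀ 𝒟 : VacuumCauchyDevelopment D, 𝒟.IsMaximal → ∀ (N : ℕ) (M a rin : Fin N → ℝ) (Λ : Fin N → ℝ → lorentzGroup) (ξ : Fin N → ℝ → E3) (γ κ τ₀ : ℝ) (U : Opens E4) (Φ : U → 𝒟.carrier) (O : Set 𝒟.carrier), ((∀ i, Kerr.IsSubextremal (M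 i) (a i) ∧ Kerr.rMinus (M i) (a i) < rin i ∧ rin i < Kerr.rPlus (M i) (a i)) ∧ (∀ i t, |((Λ i t : E4 ≃L[ℝ] E4) (E4.basisVector 0)) 0| ≤ γ) ∧ (∀ i, ContDiff ℝ ((⊤ : ℕ∞) : WithTop ℕ∞) (ξ i) ∧ ContDiff ℝ ((⊤ : ℕ∞) : WithTop ℕ∞) (fun t ↦ ((Λ i t : E4 ≃L[ℝ] E4) : E4 →L[ℝ] E4))) ∧ (∀ i j, i ≠ j → Tendsto (fun t ↦ ‖ξ i t - ξ j t‖) atTop atTop) ∧ (0 < κ ∧ κ < 1 ∧ ∀ i, ∀ᶠ t in atTop, ‖ξ i t‖ ≤ κ ^ 2 * t) ∧ ({x : E4 | τ₀ < x 0 ∧ ∀ i, rin i < Kerr.radius (a i) (poincareInv (Λ i (x 0)) (E4.ofTimeSpace (x 0) (ξ i (x 0))) x)} ⊆ (U : Set E4)) ∧ let B : ModelBackground := ⟨U, fun x ↦ Minkowski.bilin + ∑ i, (boostedKerrBilin (Λ i (x 0)) (E4.ofTimeSpace (x 0) (ξ i (x 0))) (M i) (a i) x - Minkowski.bilin), fun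 x ↦ x 0, E4.spatialNorm⟩; ContMDiff 𝓘(ℝ, E4) (𝓡 4) ((⊤ : ℕ∞) : WithTop ℕ∞) Φ ∧ Topology.IsOpenEmbedding ((B.lateRegion τ₀).restrict Φ) ∧ Φ '' {x : U | τ₀ < x.1 0 ∧ ∀ i, Kerr.rPlus (M i) (a i) < Kerr.radius (a i) (poincareInv (Λ i (x.1 0)) (E4.ofTimeSpace (x.1 0) (ξ i (x.1 0))) x.1)} ⊆ O ∧ Tendsto (fun t ↦ 𝒟.toSpacetime.deviationCk B Φ 3 t) atTop (𝓝 0) ∧ Tendsto (fun t : ℝ ↦ ⨆ x ∈ {x : U | x.1 0 = t ∧ E4.spatialNorm x.1 ≤ κ * t}, ⨆ (m : ℕ) (_ : m ≤ 3), ENNReal.ofReal (1 + √(√((⨅ i, ‖E4.spatial x.1 - ξ i t‖) ^ 7))) * ‖iteratedFDeriv ℝ m (𝒟.toSpacetime.deviationExtend B Φ) x.1‖ₑ) atTop (𝓝 0) ∧ O = Summit.FinalStateConjecture.exteriorOf 𝒟.toCauchyDevelopment (Φ '' {x : U | τ₀ < x.1 0 ∧ ∀ i, Kerr.rPlus (M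 i) (a i) < Kerr.radius (a i) (poincareInv (Λ i (x.1 0)) (E4.ofTimeSpace (x.1 0) (ξ i (x.1 0))) x.1)}) ∧ ∀ t₁ : ℝ, τ₀ < t₁ → O \ Φ '' {x : U | t₁ < x.1 0 ∧ ∀ i, Kerr.rPlus (M i) (a i) < Kerr.radius (a i) (poincareInv (Λ i (x.1 0)) (E4.ofTimeSpace (x.1 0) (ξ i (x.1 0))) x.1)} ⊆ 𝒟.metric.causalPast 𝒟.timeOrientation (Φ '' {x : U | x.1 0 = t₁ ∧ ∀ i, Kerr.rPlus (M i) (a i) < Kerr.radius (a i) (poincareInv (Λ i (x.1 0)) (E4.ofTimeSpace (x.1 0) (ξ i (x.1 0))) x.1)})) → (∀ i : Fin N, (∀ m : ℕ, 1 ≤ m → m ≤ 3 → Tendsto (fun t ↦ iteratedDeriv m (fun s ↦ (((Λ i s : lorentzGroup) : E4 ≃L[ℝ] E4) (E4.basisVector 0))) t) atTop (𝓝 0)) ∧ (∀ m : ℕ, m ≤ 2 → Tendsto (fun t ↦ iteratedDeriv m (fun s ↦ deriv (ξ i) s - (((((Λ i s : lorentzGroup) : E4 ≃L[ℝ] E4)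 (E4.basisVector 0)) 0)⁻¹ • E4.spatial (((Λ i s : lorentzGroup) : E4 ≃L[ℝ] E4) (E4.basisVector 0)))) t) atTop (𝓝 0)) ∧ (a i ≠ 0 → ∀ m : ℕ, 1 ≤ m → m ≤ 3 → Tendsto (fun t ↦ iteratedDeriv m (fun s ↦ (((Λ i s : lorentzGroup) : E4 ≃L[ℝ] E4) (E4.basisVector 3))) t) atTop (𝓝 0))) → (∀ i : Fin N, Tendsto (fun t : ℝ ↦ t ^ (3 / 4 : ℝ) * ‖deriv (fun s ↦ (((Λ i s : lorentzGroup) : E4 ≃L[ℝ] E4) (E4.basisVector 0))) t‖) atTop (𝓝 0)) → (∀ ρ : ℝ → ℝ, Tendsto ρ atTop atTop → Tendsto (fun t : ℝ ↦ ⨆ x ∈ {x : E4 | x 0 = t ∧ E4.spatialNorm x ≤ κ * t ∧ ρ t ≤ ⨅ i, ‖E4.spatial x - ξ i t‖}, ENNReal.ofReal (1 + √(√((⨅ i, ‖E4.spatial x - ξ i t‖) ^ 7))) * ‖fderiv ℝ (fun y : E4 ↦ Minkowski.bilin + ∑ i, (boostedKerrBilin (Λ i (y 0)) (E4.ofTimeSpace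 (y 0) (ξ i (y 0))) (M i) (a i) y - Minkowski.bilin)) x (E4.basisVector 0)‖ₑ) atTop (𝓝 0)) := by
  intro X _ _ _ _ _ _ D _hD 𝒟 _h𝒟 N M a rin Λ ξ γ κ τ₀ U Φ O hant hslaved hrates ρ hρ
  -- the kinematic clauses of the antecedent
  have hγ := hant.2.1
  have hsmooth := hant.2.2.1
  have hκ := hant.2.2.2.2.1
  refine weighted_fderiv_background_tendsto_zero_e0 N M a Λ ξ γ κ hγ
    (fun i ↦ ⟨(hsmooth i).1.of_le (by exact_mod_cast le_top),
      (hsmooth i).2.of_le (by exact_mod_cast le_top)⟩)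
    ⟨hκ.1.le, hκ.2.1.le, hκ.2.2⟩ (fun i ↦ ⟨2, ?_⟩) (fun i ↦ ⟨1, fun hai ↦ ?_⟩) hrates ρ hρ
  · -- bounded drift from third-order slaving (order `0` of the translational clause)
    have h0 := (hslaved i).2.1 0 (Nat.zero_le _)
    simp only [iteratedDeriv_zero] at h0
    have hev : ∀ᶠ t in atTop, ‖deriv (ξ i) t -
        ((((Λ i t : lorentzGroup) : E4 ≃L[ℝ] E4) (E4.basisVector 0)) 0)⁻¹ •
          E4.spatial (((Λ i t : lorentzGroup) : E4 ≃L[ℝ] E4) (E4.basisVector 0))‖ < 1 := by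
      have h := (tendsto_iff_norm_sub_tendsto_zero.mp h0)
      simp only [sub_zero] at h
      exact h.eventually (gt_mem_nhds one_pos)
    filter_upwards [hev] with t ht
    have hvel := norm_painted_velocity_le_one (Λ i t)
    have htri := norm_sub_norm_le (deriv (ξ i) t)
      (((((Λ i t : lorentzGroup) : E4 ≃L[ℝ] E4) (E4.basisVector 0)) 0)⁻¹ •
        E4.spatial (((Λ i t : lorentzGroup) : E4 ≃L[ℝ] E4) (E4.basisVector 0)))
    linarith
  · -- bounded axis rate from third-order slaving (order `1` of the axis clause, `aᵢ ≠ 0`)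
    have h1 := (hslaved i).2.2 hai 1 le_rfl (by norm_num)
    simp only [iteratedDeriv_one] at h1
    have h := (tendsto_iff_norm_sub_tendsto_zero.mp h1)
    simp only [sub_zero] at h
    filter_upwards [h.eventually (gt_mem_nhds one_pos)] with t ht
    exact ht.le

end Summit.FinalStateConjecture.FinalStateConjecture.Theorems.SublinearIsFree.WeightedRates

end
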